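import Mathlib
import HarnessLib

/-!
# `HeteroclinicTriggerChain` — crux `TriggerChainFrontStep` (item stmt-NavierStokesRegularity-22785):
  SEED DEPOSIT WITH FORCING (segment form)

The upper trigger of the chain obeys, on the lattice, `v′ = R(t)·v + g(t) + f(t)`: a nonnegative rate
`R = e′y + …` (receiver-driven growth, the premature-ignition clock), the SEED forcing
`g = β·s·x·u ≥ 0` (the `σ`-row seed triad, tree file `…ConnectionForm`) and a remainder `f` with
`|f| ≤ φ` (junk, tail and the other `βσ` terms). The lead's two-sided seed-deposit estimate for the
truncation (`…SeededTruncation`: `v₀ + β∫xu ≤ v(T) ≤ (v₀ + β∫xu)·exp(∫e′y)`, `f = 0`, derivatives on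
`ℝ`) is re-proved here WITH the remainder and with one-sided derivatives on the window (the regularity of
`TaoCascade.PseudoFlowOn`), the primitives `Λ = ∫R`, `G = ∫g` being supplied by the caller:

* `heteroclinicTriggerChain_forcedSeedOn`:
  `e^{Λ(T)}·(v(0) − φT) + G(T) ≤ v(T) ≤ e^{Λ(T)}·(v(0) + G(T) + φT)`.

So after a hop the next trigger holds at least the seed integral `G(T) = βs∫₀ᵀ xu` minus the amplified
remainder budget, and at most the amplified total — the two numbers behind the `log(1/β)/e` delay of the
next hop and the premature-ignition loss.

HONEST FRAMING: elementary real analysis of a scalar linear ODE with forcing on a segment; helper lemma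
for the crux (no stub credit); nothing here is a statement about the Navier–Stokes equations; no summit,
rung or crux is proved by this file.
-/

noncomputable section

set_option linter.dupNamespace false

open Real Set

namespace Summit.NavierStokesRegularity.NavierStokesRegularity.Theorems

/-- **Seed deposit with forcing, segment form.** On `[0,T]` (derivatives within the segment) let
`v′ = R·v + g + f` with `R ≥ 0`, `g ≥ 0`, `|f| ≤ φ`, and let `Λ`, `G` be primitives of `R`, `g` on the
window vanishing at `0`. Then
`e^{Λ(T)}·(v(0) − φT) + G(T) ≤ v(T) ≤ e^{Λ(T)}·(v(0) + G(T) + φT)`. [folklore] -/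
theorem heteroclinicTriggerChain_forcedSeedOn {T φ : ℝ} {v R g f Λ G : ℝ → ℝ} (hT : 0 ≤ T)
    (hv : ∀ t ∈ Icc 0 T, HasDerivWithinAt v (R t * v t + g t + f t) (Icc 0 T) t)
    (hΛ : ∀ t ∈ Icc 0 T, HasDerivWithinAt Λ (R t) (Icc 0 T) t) (hΛ0 : Λ 0 = 0)
    (hG : ∀ t ∈ Icc 0 T, HasDerivWithinAt G (g t) (Icc 0 T) t) (hG0 : G 0 = 0)
    (hR : ∀ t ∈ Icc 0 T, 0 ≤ R t) (hg : ∀ t ∈ Icc 0 T, 0 ≤ g t) (hf : ∀ t ∈ Icc 0 T, |f t| ≤ φ) :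
    Real.exp (Λ T) * (v 0 - φ * T) + G T ≤ v T ∧ v T ≤ Real.exp (Λ T) * (v 0 + G T + φ * T) := by
  have hTm : T ∈ Icc 0 T := right_mem_Icc.2 hT
  -- one-sided derivatives on [0, T)
  have toIci : ∀ {F F' : ℝ → ℝ}, (∀ t ∈ Icc 0 T, HasDerivWithinAt F (F' t) (Icc 0 T) t) →
      ∀ t ∈ Ico 0 T, HasDerivWithinAt F (F' t) (Ici t) t := fun hF t ht =>
    (hF t (Ico_subset_Icc_self ht)).mono_of_mem_nhdsWithin (Icc_mem_nhdsGE_of_mem ht)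
  have cont : ∀ {F F' : ℝ → ℝ}, (∀ t ∈ Icc 0 T, HasDerivWithinAt F (F' t) (Icc 0 T) t) →
      ContinuousOn F (Icc 0 T) := fun hF t ht => (hF t ht).continuousWithinAt
  -- Λ is nondecreasing on the window: Λ s ≤ Λ T and 0 ≤ Λ s
  have hΛle : ∀ s ∈ Icc 0 T, Λ s ≤ Λ T := by
    intro s hs
    -- fence Λ s - Λ ≤ 0 on [s, T]
    have hsub : ∀ t ∈ Icc s T, HasDerivWithinAt (fun t => Λ s - Λ t) (-R t) (Icc s T) t := by
      intro t ht
      have ht' : t ∈ Icc 0 T := ⟨hs.1.trans ht.1, ht.2⟩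
      exact ((hΛ t ht').mono (Icc_subset_Icc_left hs.1)).const_sub (Λ s) |>.congr_deriv (by ring)
    have h := image_le_of_deriv_right_le_deriv_boundary (f := fun t => Λ s - Λ t) (a := s) (b := T)
      (B := fun _ => 0) (B' := fun _ => 0)
      (fun t ht => (hsub t ht).continuousWithinAt)
      (fun t ht => (hsub t (Ico_subset_Icc_self ht)).mono_of_mem_nhdsWithin (Icc_mem_nhdsGE_of_mem ht))
      (by simp) continuousOn_const (fun t _ => (hasDerivAt_const t (0 : ℝ)).hasDerivWithinAt)
      (fun t ht => by
        have ht' : t ∈ Icc 0 T := ⟨hs.1.trans ht.1, ht.2.le⟩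
        simp only [neg_nonpos]; exact hR t ht')
      (right_mem_Icc.2 hs.2)
    linarith
  have hΛnn : ∀ s ∈ Icc 0 T, 0 ≤ Λ s := by
    intro s hs
    have h := image_le_of_deriv_right_le_deriv_boundary (f := fun t => -Λ t) (a := 0) (b := T)
      (B := fun _ => 0) (B' := fun _ => 0) (cont hΛ).neg (fun t ht => (toIci hΛ t ht).neg)
      (by simp [hΛ0]) continuousOn_const (fun t _ => (hasDerivAt_const t (0 : ℝ)).hasDerivWithinAt)
      (fun t ht => by simp only [neg_nonpos]; exact hR t (Ico_subset_Icc_self ht)) hs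
    linarith
  -- W = v · exp(-Λ)
  have hW : ∀ t ∈ Icc 0 T, HasDerivWithinAt (fun t => v t * Real.exp (-Λ t))
      (Real.exp (-Λ t) * (g t + f t)) (Icc 0 T) t := by
    intro t ht
    have h2 : HasDerivWithinAt (fun x => Real.exp (-Λ x)) (Real.exp (-Λ t) * -R t) (Icc 0 T) t :=
      (hΛ t ht).neg.exp
    have h := (hv t ht).mul h2
    refine h.congr_deriv ?_
    ring
  have hWc := cont hW
  have hW' := toIci hW
  have hexp_le : ∀ t ∈ Icc 0 T, Real.exp (-Λ t) ≤ 1 := fun t ht => by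
    rw [Real.exp_le_one_iff]; linarith [hΛnn t ht]
  have hexp_ge : ∀ t ∈ Icc 0 T, Real.exp (-Λ T) ≤ Real.exp (-Λ t) := fun t ht =>
    Real.exp_le_exp.2 (by linarith [hΛle t ht])
  have hφ : 0 ≤ φ := (abs_nonneg _).trans (hf 0 ⟨le_rfl, hT⟩)
  have hW0 : v 0 * Real.exp (-Λ 0) = v 0 := by rw [hΛ0, neg_zero, Real.exp_zero, mul_one]
  constructor
  · -- lower: -W ≤ -v 0 - e^{-Λ T} G + φ t
    have hB : ∀ t ∈ Icc 0 T, HasDerivWithinAt (fun t => -v 0 - Real.exp (-Λ T) * G t + φ * t)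
        (-(Real.exp (-Λ T) * g t) + φ) (Icc 0 T) t := by
      intro t ht
      have h := (((hG t ht).const_mul (Real.exp (-Λ T))).const_sub (-v 0)).add
        (((hasDerivAt_id t).const_mul φ).hasDerivWithinAt)
      refine h.congr_deriv ?_
      simp
    have h := image_le_of_deriv_right_le_deriv_boundary (f := fun t => -(v t * Real.exp (-Λ t)))
      (a := 0) (b := T) (B := fun t => -v 0 - Real.exp (-Λ T) * G t + φ * t)
      (B' := fun t => -(Real.exp (-Λ T) * g t) + φ) hWc.neg (fun t ht => (hW' t ht).neg)
      (by simp [hΛ0, hG0]) (cont hB) (toIci hB)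
      (fun t ht => by
        have ht' := Ico_subset_Icc_self ht
        have h1 : Real.exp (-Λ T) * g t ≤ Real.exp (-Λ t) * g t :=
          mul_le_mul_of_nonneg_right (hexp_ge t ht') (hg t ht')
        have h2 : Real.exp (-Λ t) * f t ≥ -φ := by
          have hf' := (abs_le.1 (hf t ht')).1
          have he0 : 0 ≤ Real.exp (-Λ t) := (Real.exp_pos _).le
          nlinarith [hexp_le t ht']
        show -(Real.exp (-Λ t) * (g t + f t)) ≤ -(Real.exp (-Λ T) * g t) + φ
        nlinarith)
      hTm
    -- h : -(v T e^{-Λ T}) ≤ -v 0 - e^{-Λ T} G T + φ T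
    have hpos : 0 < Real.exp (Λ T) := Real.exp_pos _
    have hinv : Real.exp (-Λ T) * Real.exp (Λ T) = 1 := by
      rw [← Real.exp_add]; simp
    have h' : v 0 - φ * T + Real.exp (-Λ T) * G T ≤ v T * Real.exp (-Λ T) := by linarith
    have h'' := mul_le_mul_of_nonneg_right h' hpos.le
    have e1 : (v 0 - φ * T + Real.exp (-Λ T) * G T) * Real.exp (Λ T) =
        Real.exp (Λ T) * (v 0 - φ * T) + G T := by
      calc (v 0 - φ * T + Real.exp (-Λ T) * G T) * Real.exp (Λ T)
          = Real.exp (Λ T) * (v 0 - φ * T) + G T * (Real.exp (-Λ T) * Real.exp (Λ T)) := by ring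
        _ = Real.exp (Λ T) * (v 0 - φ * T) + G T := by rw [hinv, mul_one]
    have e2 : v T * Real.exp (-Λ T) * Real.exp (Λ T) = v T := by rw [mul_assoc, hinv, mul_one]
    linarith
  · -- upper: W ≤ v 0 + G + φ t
    have hB : ∀ t ∈ Icc 0 T, HasDerivWithinAt (fun t => v 0 + G t + φ * t) (g t + φ) (Icc 0 T) t := by
      intro t ht
      have h := ((hG t ht).const_add (v 0)).add (((hasDerivAt_id t).const_mul φ).hasDerivWithinAt)
      refine h.congr_deriv ?_
      simp
    have h := image_le_of_deriv_right_le_deriv_boundary (f := fun t => v t * Real.exp (-Λ t))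
      (a := 0) (b := T) (B := fun t => v 0 + G t + φ * t) (B' := fun t => g t + φ) hWc hW'
      (by simp [hΛ0, hG0]) (cont hB) (toIci hB)
      (fun t ht => by
        have ht' := Ico_subset_Icc_self ht
        have hf' := (abs_le.1 (hf t ht')).2
        have he0 : 0 ≤ Real.exp (-Λ t) := (Real.exp_pos _).le
        show Real.exp (-Λ t) * (g t + f t) ≤ g t + φ
        nlinarith [hexp_le t ht', hg t ht'])
      hTm
    have hpos : 0 < Real.exp (Λ T) := Real.exp_pos _
    have hinv : Real.exp (-Λ T) * Real.exp (Λ T) = 1 := by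
      rw [← Real.exp_add]; simp
    have h' : v T * Real.exp (-Λ T) ≤ v 0 + G T + φ * T := h
    have h'' := mul_le_mul_of_nonneg_right h' hpos.le
    have e2 : v T * Real.exp (-Λ T) * Real.exp (Λ T) = v T := by rw [mul_assoc, hinv, mul_one]
    linarith

end Summit.NavierStokesRegularity.NavierStokesRegularity.Theorems

end
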